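import Literature.MathematicalPhysics.QuantumFieldTheory.Balaban1983to89.HiggsAveraging

/-!
# `Balaban1983to89.HiggsCovariance` — T. Bałaban, *(Higgs)₂,₃ quantum fields in a finite volume. I. A lower bound*,
Commun. Math. Phys. **85** (1982) 603–626 [Balaban1982Higgs1], Sect. 2 pp. 609–610: the covariant Laplace operator
with Neumann boundary conditions `−Δ^{ε,N}_{A,Ω}`, the operators `P_k(A) = Q_k^*(A)Q_k(A)` and the propagators
`G^ε_k(Ω, A)` (2.20), `G_k(Ω, A)` (2.22) as CONCRETE linear operators over the carriers `…HiggsLattice`/`…HiggsAveraging`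

statement-level skeleton of published theorems with citation tags; proofs where landed; nothing here is a claim about the Yang–Mills mass gap

PDF held: `paper:balaban1982-cmp85-higgs23-i` (journal page = PDF page + 602).  Displays read from the ×2 renders
`run/shared/lean/pub/pub-balaban/b2b-balaban-ref1/pages/1982-cmp85-higgs23-I/1982-cmp85-higgs23-I-p007, p008-x2.png` (pp. 609, 610).

CITATION HEADER (lean-in-tree rule).  Third CARRIER module of the lit-balaban typed skeleton for the (Higgs)₂,₃ papers
B1–B3 (HOME `run/shared/lean/pub/lit-balaban/`, SHARED-STRUCTURES.md §3).  WHAT IS REPRODUCED, as definitions with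
bodies (no statement of the paper is asserted): the operators behind the propositions of Sect. 2 — p. 609: *"They
are obtained by application of renormalization transformations to the basic Gaussian density
exp(−½⟨φ,(−Δ^{ε,N}_{A,Ω} + m²)φ⟩), where −Δ^{ε,N}_{A,Ω} is a covariant Laplace operator on the set Ω with Neumann
boundary conditions. A set Ω is a subset of T_ε"* (`covLaplacianN`, as the linear operator of the Dirichlet form
`Σ_{b ⊂ Ω} ε^d |(D^ε_A φ)(b)|²` restricted to the bonds INSIDE `Ω`, extended by `0` off `Ω`); (2.17)
`Δ^{(0),ε}(Ω, A) = −Δ^{ε,N}_{A,Ω} + m²` (`delta0`); the linear-map form of the averaging `Q_k(A)` of (2.11) and its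
adjoint `Q_k^*(A)` for the scalar products (1.5) of the two lattices (`avgQkLin`, `avgQkAdj`) and
`P_k(A) = Q_k^*(A)Q_k(A)` (2.20) (`projPk`); the propagator (2.20)
`G^ε_k(Ω, A) = (−Δ^{ε,N}_{A,Ω} + m² + a_k(L^kε)^{−2} P_k(A))^{−1}` (`covOpK`, `propagatorK`, inverse in the endomorphism
ring — `Ring.inverse`, value `0` if not invertible: invertibility for `m² > 0` or on `Ω = B^k(Ω^{(k)})` is a STATEMENT,
not assumed here), its matrix elements `G(x, x')` as maps of `ℝ^N` (`kernel`), and the rescaled propagator (2.22)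
`G_k(Ω, A) = (−Δ^{η,N}_{A,Ω} + m²(L^kε)² + a_k P_k(A))^{−1}` on the `η = L^{−k}` lattice, realised as the same
construction over the rescaled parameters `Params.unitAt k` (spacing `L^{−k}` at level `0`, `1` at level `k`; the
site types are definitionally unchanged) (`Params.unitAt`, `propagatorRescaled`).  DELIBERATELY NOT HERE (reader-owned
rows): (2.18)–(2.19), (2.21), Props. 2.1–2.3 ((2.23)–(2.38); typed abstractly in `…Balaban1983to89.B1` over
`B4.EtaSetting` — a Phase-2 prover instantiates `B4.EtaSetting` with `propagatorRescaled`), the field rescalings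
(1.22)–(1.23).  CONVENTIONS: as in `…HiggsLattice`/`…HiggsAveraging` (A on the bonds of the lattice on which the
operator acts — for (2.17)/(2.20) the finest lattice `T_ε = T^{(0)}`; `U(A) = exp(qεeA)` with that lattice's spacing).
Unit `lit-balaban-typer` (literature-prover-lit-balaban-typer-0); HOME/FILED.md records the proposal.
-/

open scoped BigOperators

namespace Literature.MathematicalPhysics.QuantumFieldTheory.Balaban1983to89.HiggsCovariance

open Literature.MathematicalPhysics.QuantumFieldTheory.Balaban1983to89.HiggsLattice
open Literature.MathematicalPhysics.QuantumFieldTheory.Balaban1983to89.HiggsAveraging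

variable {P : Params} {N : ℕ}

/-- Shorthand for the value space `ℝ^N` of the scalar fields. [cite: Balaban1982Higgs1, (1.5) p.604] -/
abbrev E (N : ℕ) : Type := EuclideanSpace ℝ (Fin N)

/-! ## 1. The covariant Laplace operator with Neumann boundary conditions on `Ω ⊂ T^{(k)}` (p. 609, (2.17)) -/

section Laplacian

variable {k : ℕ}

/-- One Neumann bond term of `−Δ^{η,N}_{A,Ω}` at the site `x` in the forward direction `μ`:
`φ ↦ φ(x) − U(A_{⟨x,x+ηe_μ⟩}) φ(x + ηe_μ)` if both `x, x + ηe_μ ∈ Ω`, else `0` (bond not inside `Ω`). [cite: Balaban1982Higgs1, (2.17) p.610] -/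
noncomputable def fwdTerm (C : ChargeData N) (Ω : Finset (Site P k)) (A : VecField P k) (x : Site P k) (μ : Fin P.d) :
    ScalarField P k N →ₗ[ℝ] E N :=
  if x ∈ Ω ∧ x.shift μ ∈ Ω then
    LinearMap.proj x
      - (C.U (P.mesh k) (A ⟨x, μ⟩)).toLinearMap ∘ₗ (LinearMap.proj (x.shift μ) : ScalarField P k N →ₗ[ℝ] E N)
  else 0

/-- One Neumann bond term of `−Δ^{η,N}_{A,Ω}` at the site `x` in the backward direction `μ`:
`φ ↦ φ(x) − U(A_{⟨x−ηe_μ,x⟩})* φ(x − ηe_μ)` if both `x − ηe_μ, x ∈ Ω`, else `0` (`U* = U(−A) = U⁻¹`, p. 605). [cite: Balaban1982Higgs1, (2.17) p.610] -/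
noncomputable def bwdTerm (C : ChargeData N) (Ω : Finset (Site P k)) (A : VecField P k) (x : Site P k) (μ : Fin P.d) :
    ScalarField P k N →ₗ[ℝ] E N :=
  if x ∈ Ω ∧ x.unshift μ ∈ Ω then
    LinearMap.proj x
      - (star (C.U (P.mesh k) (A ⟨x.unshift μ, μ⟩))).toLinearMap
          ∘ₗ (LinearMap.proj (x.unshift μ) : ScalarField P k N →ₗ[ℝ] E N)
  else 0

/-- The covariant Laplace operator with NEUMANN boundary conditions on `Ω ⊂ T^{(k)}` (p. 609, entering (2.17)):
`(−Δ^{η,N}_{A,Ω} φ)(x) = η⁻² Σ_μ [(φ(x) − U(A_{⟨x,x+ηe_μ⟩})φ(x+ηe_μ))·1_{⟨x,x+ηe_μ⟩ ⊂ Ω} + (φ(x) − U(A_{⟨x−ηe_μ,x⟩})*φ(x−ηe_μ))·1_{⟨x−ηe_μ,x⟩ ⊂ Ω}]`,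
i.e. the self-adjoint operator (for the scalar product (1.5)) of the quadratic form `Σ_{b ⊂ Ω} η^d |(D^η_A φ)(b)|²` in
which only the bonds with BOTH endpoints in `Ω` are kept (no boundary term — Neumann), extended by `0` outside `Ω`;
`−Δ^η_A = D^{η*}_A D^η_A` of (1.11) is the case `Ω = T`. [cite: Balaban1982Higgs1, (2.17) p.610] -/
noncomputable def covLaplacianN (C : ChargeData N) (Ω : Finset (Site P k)) (A : VecField P k) :
    ScalarField P k N →ₗ[ℝ] ScalarField P k N :=
  LinearMap.pi fun x => ((P.mesh k)⁻¹ ^ 2) • ∑ μ : Fin P.d, (fwdTerm C Ω A x μ + bwdTerm C Ω A x μ)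

/-- **(2.17)** p. 610: `Δ^{(0),ε}(Ω, A) = −Δ^{ε,N}_{A,Ω} + m²` (the starting operator of the inductive definition
(2.17)–(2.18); on the finest lattice `T_ε = T^{(0)}`, as an operator on fields extended by `0` off `Ω` the mass term
acts on all of `T_ε`). [cite: Balaban1982Higgs1, (2.17) p.610] -/
noncomputable def delta0 (C : ChargeData N) (Ω : Finset (Site P 0)) (A : VecField P 0) (msq : ℝ) :
    ScalarField P 0 N →ₗ[ℝ] ScalarField P 0 N :=
  covLaplacianN C Ω A + msq • LinearMap.id

end Laplacian

/-! ## 2. `Q_k(A)` as a linear map, its adjoint, and `P_k(A) = Q_k^*(A) Q_k(A)` ((2.11), (2.20)) -/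

section Projection

/-- The averaging operator `Q_k(A)` of (2.11) p. 609 as a LINEAR MAP `(T_ε → ℝ^N) → (T^{(k)} → ℝ^N)`:
`ψ(y) = L^{−kd} Σ_{x ∈ B^k(y)} U(A(Γ^{(k)}_{y,x})) f(x)` (same formula as `HiggsAveraging.avgQk`, packaged with its
linearity). [cite: Balaban1982Higgs1, (2.11) p.609] -/
noncomputable def avgQkLin (C : ChargeData N) (A : VecField P 0) (k : ℕ) : ScalarField P 0 N →ₗ[ℝ] ScalarField P k N :=
  LinearMap.pi fun y => (((P.L : ℝ) ^ (k * P.d))⁻¹) •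
    ∑ x ∈ blockK k y,
      (C.U (P.mesh 0) (multiContourSum A k x)).toLinearMap ∘ₗ (LinearMap.proj x : ScalarField P 0 N →ₗ[ℝ] E N)

/-- `avgQkLin` is the function `HiggsAveraging.avgQk` (2.11). [cite: Balaban1982Higgs1, (2.11) p.609] -/
theorem avgQkLin_apply (C : ChargeData N) (A : VecField P 0) (k : ℕ) (f : ScalarField P 0 N) (y : Site P k) :
    avgQkLin C A k f y = avgQk C A k f y := by
  simp [avgQkLin, avgQk_apply, LinearMap.sum_apply]

/-- The adjoint `Q_k^*(A)` of `Q_k(A)` with respect to the scalar products (1.5) of `T_ε` (weight `ε^d`) and of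
`T^{(k)}` (weight `(L^kε)^d`; p. 607): `(Q_k^*(A)ψ)(x) = U(A(Γ^{(k)}_{x_k,x}))* ψ(x_k)`, `x_k` the block point of `x`
(the weights `ε^d · L^{−kd} · (L^kε)^{−d}… ` combine to `1`: `⟨Q_k f, ψ⟩_{T^{(k)}} = Σ_y (L^kε)^d ⟨L^{−kd}Σ_{x∈B^k(y)} U_x f(x), ψ(y)⟩
= Σ_x ε^d ⟨f(x), U_x* ψ(x_k)⟩`).  Used in `P_k(A) = Q_k^*(A)Q_k(A)` (2.20). [cite: Balaban1982Higgs1, (2.20) p.610] -/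
noncomputable def avgQkAdj (C : ChargeData N) (A : VecField P 0) (k : ℕ) : ScalarField P k N →ₗ[ℝ] ScalarField P 0 N :=
  LinearMap.pi fun x =>
    (star (C.U (P.mesh 0) (multiContourSum A k x))).toLinearMap
      ∘ₗ (LinearMap.proj (blockIter k x) : ScalarField P k N →ₗ[ℝ] E N)

/-- **(2.20)** p. 610, second display: `P_k(A) = Q_k^*(A) Q_k(A)`, an operator on fields on `T_ε`. [cite: Balaban1982Higgs1, (2.20) p.610] -/
noncomputable def projPk (C : ChargeData N) (A : VecField P 0) (k : ℕ) : ScalarField P 0 N →ₗ[ℝ] ScalarField P 0 N :=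
  avgQkAdj C A k ∘ₗ avgQkLin C A k

end Projection

/-! ## 3. The propagators `G^ε_k(Ω, A)` (2.20) and `G_k(Ω, A)` (2.22) -/

section Propagator

/-- The operator inverted in (2.20) p. 610: `−Δ^{ε,N}_{A,Ω} + m² + a_k (L^kε)^{−2} P_k(A)` on fields on `T_ε`
(`a_k = B1.aSeq a L k`, (2.15)). [cite: Balaban1982Higgs1, (2.20) p.610] -/
noncomputable def covOpK (C : ChargeData N) (Ω : Finset (Site P 0)) (A : VecField P 0) (msq a : ℝ) (k : ℕ) :
    ScalarField P 0 N →ₗ[ℝ] ScalarField P 0 N :=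
  covLaplacianN C Ω A + msq • LinearMap.id + (B1.aSeq a P.L k * ((P.mesh k)⁻¹ ^ 2)) • projPk C A k

/-- **(2.20)** p. 610: the propagator `G^ε_k(Ω, A) = (−Δ^{ε,N}_{A,Ω} + m² + a_k(L^kε)^{−2} P_k(A))^{−1}`, as the inverse
in the endomorphism ring of the fields on `T_ε` (`Ring.inverse`: the two-sided inverse when `covOpK` is invertible —
e.g. `m² > 0` — and the junk value `0` otherwise; invertibility is part of the STATEMENTS about `G_k`, not assumed). [cite: Balaban1982Higgs1, (2.20) p.610] -/
noncomputable def propagatorK (C : ChargeData N) (Ω : Finset (Site P 0)) (A : VecField P 0) (msq a : ℝ) (k : ℕ) :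
    Module.End ℝ (ScalarField P 0 N) :=
  Ring.inverse (covOpK C Ω A msq a k)

/-- The matrix element `G(x, x')` of an operator on fields, as a linear map of `ℝ^N`
(`G(x, x') v = (G (v·δ_{x'}))(x)`; the kernels `G_k(Ω, A; x, x')` bounded in Props. 2.1–2.3). [cite: Balaban1982Higgs1, (2.24) p.610] -/
noncomputable def kernel {k : ℕ} (G : Module.End ℝ (ScalarField P k N)) (x x' : Site P k) : E N →ₗ[ℝ] E N :=
  (LinearMap.proj x : ScalarField P k N →ₗ[ℝ] E N) ∘ₗ G ∘ₗ LinearMap.single ℝ (fun _ : Site P k => E N) x'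

end Propagator

/-! ## 4. The rescaled propagator `G_k(Ω, A)` on the `η = L^{−k}` lattice ((2.22)) -/

/-- The rescaled parameters of p. 610: the same combinatorial tori with the spacing `η = L^{−k}` at level `0` (so that
level `k` is the UNIT lattice `T_1^{(k)}`): `ε ↦ L^{−k}`.  `Site (P.unitAt k) j = Site P j` definitionally (the site
counts do not involve `ε`), so fields transfer by the identity; the FIELD rescaling (1.22) is reader-level. [cite: Balaban1982Higgs1, (2.22) p.610] -/
noncomputable def _root_.Literature.MathematicalPhysics.QuantumFieldTheory.Balaban1983to89.HiggsLattice.Params.unitAt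
    (P : Params) (k : ℕ) : Params :=
  { P with ε := ((P.L : ℝ) ^ k)⁻¹, hε := inv_pos.mpr (pow_pos (Nat.cast_pos.mpr P.hL) k) }

/-- The spacing of the rescaled family at level `0` is `η = L^{−k}`. [cite: Balaban1982Higgs1, (2.22) p.610] -/
theorem mesh_unitAt_zero (P : Params) (k : ℕ) : (P.unitAt k).mesh 0 = ((P.L : ℝ) ^ k)⁻¹ := by
  simp [Params.unitAt, Params.mesh]

/-- The rescaled family has spacing `1` at level `k` (`L^k η = 1`, p. 610). [cite: Balaban1982Higgs1, (2.22) p.610] -/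
theorem mesh_unitAt_self (P : Params) (k : ℕ) : (P.unitAt k).mesh k = 1 := by
  have : (0 : ℝ) < (P.L : ℝ) ^ k := pow_pos (by exact_mod_cast P.hL) k
  simp [Params.unitAt, Params.mesh, this.ne']

/-- **(2.22)** p. 610: the rescaled propagator `G_k(Ω, A) = (−Δ^{η,N}_{A,Ω} + m²(L^kε)² + a_k P_k(A))^{−1}` on the
`η = L^{−k}` lattice — the construction (2.20) over the rescaled parameters `P.unitAt k` (there `a_k(L^kη)^{−2} = a_k`)
with the mass `m²(L^kε)²`; `A` is a vector field on the bonds of `T_η` (same index type as for `T_ε`). [cite: Balaban1982Higgs1, (2.22) p.610] -/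
noncomputable def propagatorRescaled (P : Params) (C : ChargeData N) (k : ℕ) (Ω : Finset (Site (P.unitAt k) 0))
    (A : VecField (P.unitAt k) 0) (msq a : ℝ) : Module.End ℝ (ScalarField (P.unitAt k) 0 N) :=
  propagatorK C Ω A (msq * P.mesh k ^ 2) a k

end Literature.MathematicalPhysics.QuantumFieldTheory.Balaban1983to89.HiggsCovariance
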